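import Summits.ValiantsHypothesis.ValiantsHypothesis.Theorems.LMRWhatWouldSuffice
import Literature.Computability.AlgebraicComplexity.LMR13DualVarieties
import Literature.Computability.AlgebraicComplexity.MignonRessayreBound
import Literature.Computability.AlgebraicComplexity.MignonRessayreCharZero
import HarnessLib

/-!
# What would suffice — the LMR corpus, part 3: the border link in Landsberg–Manivel–Ressayre's own
# vocabulary (`borderDc`, val-lit-t11's `LMR13DualVarieties.lean`) against rungs V0 / V6

val-lit bookkeeping file (unit `val-lit-lead-lmr`, D-0074), companion of `LMRWhatWouldSuffice.lean`
(p416561) and `LMRWhatWouldSufficeTyped.lean`. HONEST FRAMING: nothing in this file is progress on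
`VP ≠ VNP`; it records, as kernel-checked implications ending in EXISTING rung declarations, what the
GCT / border side of the corpus (GAP-LEDGER row LMR-2) would have to supply. The open link is a
HYPOTHESIS `(h : …)`; no conjecture is asserted and no new `Prop` is introduced.

* `borderDc_perPoly_le_determinantalComplexity`: for `m ≥ 3`, LMR's border determinantal complexity
  `\overline{dc}(per_m)` — typed by val-lit-t11 as `borderDc (perPoly (Fin m) ℂ) m` (least `n ≥ m`
  with `ℓ^{n−m} per_m ∈ \overline{GL_{n²}·det_n}` for SOME placement; LMR 2013 §1.1) — is at most
  `dc(per_m)`. PROVED from t11's `hasBorderDetReprOf_of_hasDetRepr` (Mulmuley–Sohoni Prop. 4.4 in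
  the tree) at the size `n = dc(per_m)` attained by Valiant universality; the only point is that the
  `m² + 1` entries (variables + padding slot) fit into an `n × n` matrix, which holds because
  `m² ≤ 2·dc(per_m)` (Mignon–Ressayre, PROVED in tree:
  `sq_le_two_mul_determinantalComplexity_perPoly_complex_holds`) and `dc(per_m) ≥ m ≥ 3`.
  (The companion file's `detqpThesis_of_border_not_qp` is the same link over the tree's fixed-placement
  `borderDetComplexityPer`; this one is over LMR's notion as printed.)
* `detqpThesis_of_borderDc_not_qp`, `valiantsHypothesis_of_borderDc_not_qp`: hence «`\overline{dc}(per_m)`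
  is not quasi-polynomially bounded» (the GCT form of the separation, OPEN; LMR's equations give only
  `\overline{dc}(per_m) ≥ m²/2`, Thm. 1.1.1, PROVED in tree as `LMR2013_thm_1_1_1_holds`, and the border
  Hessian engine PROVED by t11, `rank_hessianMatrix_le_of_mem_orbitClosure_detPoly`, sits under the same
  `#variables` wall as the affine one) implies `Theses.DetQP.DetqpThesis` (stmt-ValiantsHypothesis-0315,
  V0) and `_root_.ValiantsHypothesis` (V6, through the CLOSED `DcqpToVH`), by the companion file's
  engine template.

References: J. M. Landsberg, L. Manivel, N. Ressayre, *Hypersurfaces with degenerate duals and the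
geometric complexity theory program*, Comment. Math. Helv. 88 (2013) 469–484, arXiv:1004.4802, §1.1,
Thm. 1.1.1; K. Mulmuley, M. Sohoni, *GCT I*, SIAM J. Comput. 31 (2001), Prop. 4.4; T. Mignon,
N. Ressayre, *A quadratic bound for the determinant and permanent problem*, IMRN 2004:79, Thm. 1.1.
-/

set_option linter.dupNamespace false

namespace Summit.ValiantsHypothesis.ValiantsHypothesis.Theorems.LMRWhatWouldSufficeBorder

open Literature.Computability.AlgebraicComplexity
open Summit.ValiantsHypothesis.ValiantsHypothesis.Theorems.LMRWhatWouldSuffice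
open MvPolynomial

noncomputable section

/-- **`\overline{dc}(per_m) ≤ dc(per_m)` in LMR's vocabulary, `m ≥ 3`.** The affine representation of
size `n = dc(per_m)` (attained, `hasDetRepr_determinantalComplexity_holds`) puts every padded
`ℓ^{n−m} per_m` in `\overline{GL_{n²}·det_n}` (t11's `hasBorderDetReprOf_of_hasDetRepr`), provided the
`m²` variables and one padding slot fit into the `n²` entries: `m² + 1 ≤ n²`, which follows from
`m² ≤ 2n` (Mignon–Ressayre, PROVED) and `n ≥ m ≥ 3`.
[cite: LandsbergManivelRessayre2013, §1.1 (p. 470)] -/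
theorem borderDc_perPoly_le_determinantalComplexity {m : ℕ} (hm : 3 ≤ m) :
    borderDc (perPoly (Fin m) ℂ) m ≤ determinantalComplexity (perPoly (Fin m) ℂ) := by
  classical
  set n := determinantalComplexity (perPoly (Fin m) ℂ) with hn
  have hA : HasDetRepr (perPoly (Fin m) ℂ) n := hasDetRepr_determinantalComplexity_holds _
  have hmn : m ≤ n := by
    simpa [Fintype.card_fin] using card_le_determinantalComplexity_perPoly (Fin m) ℂ
  have hsq : m ^ 2 ≤ 2 * n := sq_le_two_mul_determinantalComplexity_perPoly_complex_holds hm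
  have hcard : Fintype.card (Fin m × Fin m) + 1 ≤ n * n := by
    have hmm : m * m ≤ 2 * n := by simpa [sq] using hsq
    have h3n : 3 ≤ n := hm.trans hmn
    simp only [Fintype.card_prod, Fintype.card_fin]
    nlinarith [hmm, h3n]
  have hP : (perPoly (Fin m) ℂ).IsHomogeneous m := by
    simpa [Fintype.card_fin] using (perPoly_isHomogeneous (n := Fin m) (k := ℂ))
  have hB : HasBorderDetReprOf (perPoly (Fin m) ℂ) m n :=
    hasBorderDetReprOf_of_hasDetRepr hP hmn hA hcard
  exact Nat.sInf_le ⟨hmn, hB⟩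

/-- **Border link, V0 form (LMR vocabulary).** If `m ↦ \overline{dc}(per_m)` (`borderDc`, LMR 2013
§1.1) is not quasi-polynomially bounded, then `DetqpThesis` (stmt-ValiantsHypothesis-0315): by
`borderDc_perPoly_le_determinantalComplexity` and the companion file's engine template. The hypothesis
is OPEN (it is the GCT form of the permanent–determinant separation); LMR's equations give
`\overline{dc}(per_m) ≥ m²/2` only. [cite: LandsbergManivelRessayre2013, §1.1 (p. 470)] -/
theorem detqpThesis_of_borderDc_not_qp
    (h : ¬ IsQPBounded fun m => borderDc (perPoly (Fin m) ℂ) m) : Theses.DetQP.DetqpThesis :=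
  detqpThesis_of_eventual_lower_bound h
    ⟨3, fun _ hm => borderDc_perPoly_le_determinantalComplexity hm⟩

/-- **Border link, summit form (LMR vocabulary).** The same hypothesis gives `VP ℂ ≠ VNP ℂ`
(`_root_.ValiantsHypothesis`, rung V6) through route DetQP's `closes` and the CLOSED `DcqpToVH`.
[cite: LandsbergManivelRessayre2013, §1.1 (p. 470)] -/
theorem valiantsHypothesis_of_borderDc_not_qp
    (h : ¬ IsQPBounded fun m => borderDc (perPoly (Fin m) ℂ) m) : _root_.ValiantsHypothesis :=
  valiantsHypothesis_of_eventual_lower_bound h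
    ⟨3, fun _ hm => borderDc_perPoly_le_determinantalComplexity hm⟩

end

end Summit.ValiantsHypothesis.ValiantsHypothesis.Theorems.LMRWhatWouldSufficeBorder
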